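import Summits.ResolutionOfSingularities.ResolutionOfSingularities.Theorems.HilbertSamuelEliminationSigmaMaxModificationsCorridor3WLadderShadowM
import Summits.ResolutionOfSingularities.ResolutionOfSingularities.Theorems.HilbertSamuelEliminationSigmaMaxModificationsCorridor3WLadderMovingCells
import HarnessLib

/-!
# [OURS · L1 W4.2] MODULE `Corridor3WLadderShadowM2Defs` — the (2,3)-CELL INSTANCE VOCABULARY `Cell23` for `ShadowLawM p 3 Q Is23Stage`
# (crux chain w42, idea-1 ROUND 5 §I.4 «G6 — (2,3)-cell law at p ≥ 3: INSTANCE SPEC for res-type-067 (typer of record)»)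

PROVENANCE. Typer res-type-067 (gen 11), TYPER OF RECORD for this object per res-L1-w42-plan-1 RULINGS v3.9-3 (K) 2026-08-27T06:14:03Z /
v3.10-1 (F-i) 06:48:59Z («067 = typer reserve for idea-1's G6 (2,3)-cell instance spec») and res-L1-w42-idea-1 gen 5, STATUS 07:16:30Z (3):
«G6 (2,3)-cell INSTANCE SPEC for 067 = IDEAS §I.4 (St₂ = generating points of CJS's own Δ(h;u₁,u₂;Z,u₃) ⊂ ℝ², Reads₂, laws origin₂/translate₂/
exit-to-(3,3)/waiting, T := CJS e=2 β-termination …; p ≥ 3 via Thm 3.14 p499700/p503241; p = 2 OPEN) — I did NOT type it this round; 067 may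
start from ShadowMDefs §3 with Fin 2» (`HOME/L/res-L1-w42-idea-1/IDEAS.md` v5 sha16 23e35a2a198e4dc2 §I.4). TYPER'S READING (plan-1 may re-cut);
OURS throughout; NOT a statement of any manuscript — [Hironaka2017] is never a premise; nothing here is a claim about resolution of
singularities in characteristic `p`. AI-typed; AI review is weaker than expert review. No `sorry`; one 3-line theorem (the reduction).

WHAT THIS IS. The tree's reading-valued shadow law `ShadowM.ShadowLawM p N Q G` (p501775, idea-1 C3 §2) concludes the MOVING row
`Moving.MaxOriginNoMovingNearChainAtQ p N Q G` (p502382 `maxOriginNoMovingNearChainAtQ_of_shadowLawM`). Card C′ instantiates it on the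
grade cell `G := (3 ≤ ē)` with 3-dimensional polyhedral states (`CPrime`, §3–§5 of `…ShadowMDefs`). The (2,3)-CELL (`Moving.Is23Stage`,
res-type-053 T6 p503947: `e(x_n) = dirDim = 2 < ē(x_n) = geomDirDim = 3`, imperfect `κ(x_n)` only) was split off because the C′ reading
(`Reads`, Δ³ minimal of grade 3) does not exist there (idea-1 IDEAS v4 §G6 / v5 §I.4: `in_𝔪 h = F(Y₁,Y₂)`, `F = c·ℓ^m` over `κ̄` only). idea-1's
§I.4: «At `p ≥ 3` the printed char hypothesis of CJS Thm 3.14 holds on threefolds … ⇒ every near point of the point blow-up lies on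
`ℙ(Dir_κ) = ℙ¹_{(u₁:u₂)}`. SPEC (`ShadowLawM p 3 Q G T` shape of `…ShadowMDefs` §3, with): `G s := s.geomDirDim = 3 ∧ dirDim_κ s = 2`; state
`St₂ := {A : Finset (Fin 2 → ℚ), lab, n}` = generating points of CJS's OWN `Δ(h; u₁,u₂; y₁,y₂) ⊂ ℝ²≥0` (Ch. 7–8 setting for the hypersurface `h`
with the TWO κ-directrix variables `y₁ = Z`, `y₂ = u₃` after a κ-linear change making `in_𝔪 h ∈ κ[Y₁,Y₂]`, and `u = (u₁,u₂)`) + labels; `Pre :=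
Reads₂` (presentation with (y₁,y₂;u₁,u₂) κ-rational, Δ² well-prepared, Ch. 8); `law := law_origin₂ ∨ law_translate₂` (the e = 2 moves of CJS
Ch. 11–13 on ℝ²: origin of the `u_{j₀}`-chart = `σ_{univ(2),j₀}`, translation along `ℙ¹` = Perron/re-preparation) ∨ `law_exit` (α becomes
κ(x′)-rational ⇒ successor in the (3,3) cell, handed to C′/C4) ∨ `law_waiting`; `T := G2LStarTerminates` … p ≥ 3 only; p = 2 OPEN.
Deliverables for 067: `ShadowLawM₂Defs` (St₂, Reads₂, the three laws) + `shadowLawM_of_cell23 : (facts) → ShadowLawM p 3 Q G_{23} St₂…` statement».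

THIS FILE (everything OURS; names suffixed `₂`; same namespace as C3's landed vocabulary so that both readings live side by side):
§1  G2L* — `…ShadowMDefs` §3 VERBATIM WITH `Fin 2` IN PLACE OF `Fin 3`: `ShadowState₂`, `IsNearFace₂`, `IsNearComp₂`, `IsGrade₂` (δ(Δ²) > 1,
    i.e. the frame (y₁,y₂) is a κ-directrix frame, `in_𝔪 h ∈ κ[Y₁,Y₂]`), `IsCanonCentreAt₂`, `shadowMoveT₂ Fs S i` (centre `V(y, u_{Fs})`:
    `Fs = univ` the point, `Fs = {j}` the curve `V(y₁,y₂,u_j)`; chart `u_i`, `i ∈ Fs`; `S = ∅` ORIGIN move, `S = {j}` TRANSLATED move along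
    `ℙ¹ = ℙ(Dir_κ)`), `ShadowStepStar₂` (CJS's label rule verbatim), `G2LStarTerminates` — an OURS CLAIM about the 2-dimensional game,
    kit-testable like `G3LStarTerminates`; it is NOT typed as a printed fact: CJS Chs. 11–14 prove termination of their e = 2 sequence under
    the standing assumption (F3) «`e_x ≤ 1 ∨ e_x = ē_x`» (LNM 2270 p. 103, quoted in 053's `Moving.IsDirDropStage`), which FAILS on the (2,3)
    cell (`e = 2 < ē = 3`); idea-1's «T := CJS e=2 β-termination AS A NAMED FACT restricted to this reading» is therefore carried as this
    OURS claim and NOT as a `Literature` fact (a restatement for `e < ē` would not be a printed statement).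
§2  READINGS over the tree's Cossart–Piltant API (`CossartPiltant.minExponents`, generic in the number of parameters): `genPoints₂ u h` = the
    generating points `(a₀, a₁)/(i − a₂)` (`a ∈ 𝐒(h_{m−i})`, `a₂ < i`) of CJS's 2-dimensional polyhedron `Δ(h; u₀,u₁; X,u₂)` read off a CP frame
    `(u₀,u₁,u₂; X)` whose LAST parameter `u₂` is the second directrix variable `y₂` (terms with `a₂ ≥ i` have order `≥ m`; exponents above a
    minimal one give dominated points — harmless, every predicate of G2L* reads minima); `faceIdeal₂ u h F = (X̄, ū₂, ū_j : j ∈ F)`; `Reads₂ prep`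
    = C3's `Reads` with `Fin 2` faces and `genPoints₂`, and with the PREPARATION CLAUSE `prep u h` in place of CP's `IsMinimal u h`: the
    (2,3)-preparation notion («Δ² well-prepared, Ch. 8», i.e. CJS's normalised/δ-prepared (f; y; u) for TWO y-variables) is NOT in the tree —
    CP's `IsMinimal u h` is minimality of the 3-dimensional `Δ(h;u;X)` over `X ↦ X − φ` and is NOT the right notion at `e < ē` — so it is carried
    as a PARAMETER here and as the FIELD `prep` of the instance structure (a definition request, flagged; exactly as `ShadowLawM.reads` is
    abstract and `CPrime` makes it concrete). EXISTENCE / CORRECT CHOICE OF `prep` NOT SHOWN HERE.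
§3  `Cell23 p Q` — the (2,3)-cell claims in the shape of C3's `CPrime`: `prep`, the rank carrier `W, wlt, wf, rk` (rank descent = a near point of
    `ℙ¹` that is NOT `κ(x_n)`-rational / residue-field extension, as K3a), `cover₂`, `fidelity₂`, `law_moving₂`, `law_waiting₂`, `g2l`, all
    relative to `G := Moving.Is23Stage` (REUSED from 053's T6, not re-typed) at level `N = 3`; EXIT to the (3,3) cell is a canonical step whose
    target is not a (2,3)-stage and is therefore OUTSIDE the law by construction (handed to C′/C4, idea-1 §I.4) — `ShadowLawM.law_moving`
    only binds steps with `G s ∧ G s'`. PACKAGING `shadowLawM_of_cell23 : Cell23 p Q → ShadowLawM p 3 Q Moving.Is23Stage` (where-block, as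
    `shadowLawM_of_cPrime`) and the PROVED 3-line reduction `maxOriginNoMovingNearChainAtQ_of_cell23` (tree p502382).
WHERE AN INSTANCE IS EXPECTED: `p ≥ 3` (idea-1 §I.4: near points of the point blow-up at a (2,3)-stage of a threefold lie on `ℙ(Dir_κ) = ℙ¹`
by CJS Thm 3.14 — tree facts `CossartJannsenSaito2020_thm_3_14` p499700 / `Thm314_point_locus` p503241 — so every genuine step is an
origin₂ / translate₂ move or a residue extension); `p = 2` OPEN (no κ-rational frame: idea-1 IDEAS v4 §G6, Hironaka–Mizutani origins; RULINGS
v3.10-1 (D): CONFINED modulo Dietel F-58, termination still OURS). NOTHING in this file asserts that an instance exists.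

COSTUME / T1 AUDIT. As for `CPrime`: `St := ShadowState₂`, `step := ShadowStepStar₂`, `good := IsGrade₂ ∘ A`, `reads := Reads₂ prep` are DEFINED;
`prep` and `rk` are the instance's data; the trivial reading is blocked by `law_waiting₂` + the label dictionary exactly as in C3. `Cell23` is
inhabited only by supplying the five claims; `G2LStarTerminates` is refutable by ONE infinite G2L* play.

References (for the OURS modelling; nothing is restated as a fact): V. Cossart, U. Jannsen, S. Saito, LNM 2270 (2020), Chs. 7–8 (the
polyhedron `Δ(f;y;u)` and preparation), Chs. 11–14 (the e = 2 sequence), Thm. 3.14, standing assumption (F3) p. 103 [CossartJannsenSaito2020];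
V. Cossart, O. Piltant, arXiv:1412.0868 Def. 2.1/2.3/2.4, Prop. 2.6 (tree `CossartPiltant.minExponents` / `IsMinimal` / origin chart)
[CossartPiltant2019].
-/

noncomputable section

open CategoryTheory AlgebraicGeometry TopologicalSpace Topology Polynomial
open Literature.AlgebraicGeometry.Resolution
open Summit.ResolutionOfSingularities.ResolutionOfSingularities.Theorems.CampaignW42

-- 0-warning rule of the gate (the summit namespace `ResolutionOfSingularities.ResolutionOfSingularities` is flagged by the linter)
set_option linter.dupNamespace false

namespace Summit.ResolutionOfSingularities.ResolutionOfSingularities.Theorems.SigmaMaxModificationsCorridor3.ShadowM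

universe u

open Summit.ResolutionOfSingularities.ResolutionOfSingularities.Theorems.SigmaMaxModificationsCorridor3.Helpers (InScopeCQ QPointed)
open Summit.ResolutionOfSingularities.ResolutionOfSingularities.Theorems.SigmaMaxModificationsCorridor3.Moving

/-! ## §1. THE 2-DIMENSIONAL LABEL GAME G2L* (`…ShadowMDefs` §3 verbatim with `Fin 2`) -/

/-- [OURS · L1 W4.2] A SHADOW STATE of the (2,3) cell: generating points of CJS's 2-dimensional polyhedron `Δ(h; u₀,u₁; y₁,y₂) ⊂ ℚ²_{≥0}`
in a (2,3)-prepared frame, labels of the coordinate subspaces `V(y₁, y₂, u_F)`, `F ⊆ {0,1}`, and the stage counter (`ShadowState` with `Fin 2`).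
NOT a statement of any manuscript. -/
structure ShadowState₂ where
  /-- generating points of the 2-dimensional polyhedron -/
  A : Finset (Fin 2 → ℚ)
  /-- label (year of birth) of the coordinate subspace `V(y₁, y₂, u_F)`, `F ⊆ {0,1}` -/
  lab : Finset (Fin 2) → ℕ
  /-- stage -/
  n : ℕ

/-- [OURS] `V(y, u_F)` lies in the top locus: `Σ_{j∈F} a_j ≥ 1` on every generating point (`IsNearFace` with `Fin 2`). -/
def IsNearFace₂ (A : Finset (Fin 2 → ℚ)) (F : Finset (Fin 2)) : Prop :=
  ∀ a ∈ A, (1 : ℚ) ≤ ∑ j ∈ F, a j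

/-- [OURS] a near COMPONENT through the point: an inclusion-minimal near index set (`IsNearComp` with `Fin 2`). -/
def IsNearComp₂ (A : Finset (Fin 2 → ℚ)) (F : Finset (Fin 2)) : Prop :=
  F.Nonempty ∧ IsNearFace₂ A F ∧ ∀ G : Finset (Fin 2), G ⊂ F → G.Nonempty → ¬ IsNearFace₂ A G

/-- [OURS] (2,3)-grade state: nonnegative generating points with `δ(Δ²) > 1` — i.e. `in_𝔪 h ∈ κ[Y₁, Y₂]`, the frame `(y₁, y₂)` is a
`κ`-DIRECTRIX frame (`IsGrade3` with `Fin 2`). -/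
def IsGrade₂ (A : Finset (Fin 2 → ℚ)) : Prop :=
  A.Nonempty ∧ (∀ a ∈ A, ∀ j, (0 : ℚ) ≤ a j) ∧ ∀ a ∈ A, (1 : ℚ) < ∑ j, a j

/-- [OURS] CJS's centre rule with the oldest label `l` explicit (`IsCanonCentreAt` with `Fin 2`): `l` is the least label of a near component,
and `F*` is the union of the index sets of the label-`l` components (`F* = univ`: the point; `F* = {j}`: the curve `V(y₁, y₂, u_j)`). -/
def IsCanonCentreAt₂ (s : ShadowState₂) (l : ℕ) (Fs : Finset (Fin 2)) : Prop :=
  (∃ F, IsNearComp₂ s.A F ∧ s.lab F = l) ∧ (∀ F, IsNearComp₂ s.A F → l ≤ s.lab F) ∧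
    ∀ j : Fin 2, j ∈ Fs ↔ ∃ F, IsNearComp₂ s.A F ∧ s.lab F = l ∧ j ∈ F

/-- [OURS] THE LOCAL MOVE on generating points for the blow-up of `V(y, u_{F*})`, chart `u_i` (`i ∈ F*`), at the `κ`-rational point of
`ℙ(Dir_κ)` with non-zero coordinates `S ⊆ F* ∖ {i}`: `a_i ↦ |a|_{F*} − 1`, `a_j ↦ 0` (`j ∈ S`), other coordinates unchanged (`shadowMoveT` with
`Fin 2`; `S = ∅` is the ORIGIN₂ move — the origin of the `u_i`-chart, CJS Chs. 11–13 / CP Prop. 2.6 —, `S = {j}` the TRANSLATE₂ move along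
`ℙ¹ = ℙ(Dir_κ)`). -/
def shadowMoveT₂ (Fs S : Finset (Fin 2)) (i : Fin 2) (a : Fin 2 → ℚ) : Fin 2 → ℚ :=
  fun j => if j = i then (∑ k ∈ Fs, a k) - 1 else if j ∈ S then 0 else a j

open Classical in
/-- [OURS] ONE MOVE OF G2L* (`ShadowStepStar` with `Fin 2`): a canonical blow-up read at a `κ`-RATIONAL near point of chart `u_i` (origin₂ or
translate₂), again of (2,3)-grade, with CJS's label rule on coordinate subspaces: `V(y', u'_G)` with `i ∈ G` lies in the exceptional divisor and its
image closure is `V(y, u_{F* ∪ G})`, a component downstairs iff the centre is the unique oldest component and `G ⊆ F*` (then it inherits `l`), else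
it is born this year; `i ∉ G` is a strict transform and keeps its label. -/
def ShadowStepStar₂ (s s' : ShadowState₂) : Prop :=
  ∃ (l : ℕ) (Fs S : Finset (Fin 2)) (i : Fin 2), IsCanonCentreAt₂ s l Fs ∧ i ∈ Fs ∧ S ⊆ Fs.erase i ∧
    s'.A = s.A.image (shadowMoveT₂ Fs S i) ∧ IsGrade₂ s'.A ∧ s'.n = s.n + 1 ∧
    ∀ G : Finset (Fin 2), s'.lab G =
      if i ∈ G then (if (∀ F, IsNearComp₂ s.A F → s.lab F = l → F = Fs) ∧ G ⊆ Fs then l else s.n + 1) else s.lab G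

/-- [OURS · L1 W4.2] **`G2LStarTerminates`** — every G2L* play from a (2,3)-grade state is finite (for ALL label assignments and stage
counters); the 2-dimensional analogue of `G3LStarTerminates`, kit-testable in the same engine with `Fin 2`. AN OURS CLAIM, NOT A PRINTED FACT:
CJS (LNM 2270) Chs. 11–14 prove that their e = 2 fundamental sequences terminate under the standing assumption (F3) «`e_x ≤ 1 ∨ e_x = ē_x`»
(p. 103), which FAILS on the (2,3) cell (`e = 2 < ē = 3`) — so their theorem is NOT restated here as a `Literature` fact «restricted to this
reading»; whether the 2-dimensional shadow of the (2,3) cell obeys the same combinatorics is exactly what this claim and `Cell23.law_moving₂`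
assert. EVIDENCE (typer's local smoke test of THIS game, 2026-08-27, script `HOME/L/res-type-067/g2l-main.py` = idea-1's `g3c/main.py`
PART A* with `3 ↦ 2`): 6 931 (2,3)-grade starts (generating points on the grids `¼ℤ², ⅙ℤ², ¹⁄₁₂ℤ²`, ≤ 3 generators, pointed and non-pointed),
origin moves alone and origin + translated moves: NO cycle, no cap hit, longest play 14 (start `{(1, 35/12)}`); a full kit run is offered, not
yet run. WHY IT MIGHT FAIL: one infinite play (a cycle up to labels/stage) refutes it. NOT a statement of any manuscript. -/
def G2LStarTerminates : Prop :=
  ∀ f : ℕ → ShadowState₂, IsGrade₂ (f 0).A → ¬ ∀ n, ShadowStepStar₂ (f n) (f (n + 1))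

/-! ## §2. READINGS of a (2,3)-stage over the tree's Cossart–Piltant API -/

section Readings

open Literature.AlgebraicGeometry.Resolution.CossartPiltant

variable {R : Type} [CommRing R]

/-- [OURS] The generating points of CJS's 2-dimensional polyhedron `Δ(h; u₀,u₁; X,u₂) ⊂ ℚ²_{≥0}` of `h = X^m + Σ_{i=1}^{m} h_{m−i} X^{m−i} ∈ R[X]`
in a CP frame `u = (u₀,u₁,u₂)` whose LAST parameter `u₂` is the second directrix variable `y₂`: the term `X^{m−i} u^a` (`a ∈ 𝐒(h_{m−i})`, tree
`CossartPiltant.minExponents`) has `y`-degree `m − i + a₂` and contributes the point `(a₀, a₁)/(i − a₂)` when `a₂ < i` (terms with `a₂ ≥ i` have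
order `≥ m`); exponents above a minimal one give dominated points, harmless since every predicate of G2L* reads minima over the set.
NOT a statement of any manuscript. [cite: CossartJannsenSaito2020, Ch. 7 (the polyhedron Δ(f;y;u))] [cite: CossartPiltant2019, Def. 2.1 and Def. 2.3 (arXiv v1 pp. 10–11)] -/
def genPoints₂ (u : Fin 3 → R) (h : R[X]) : Finset (Fin 2 → ℚ) :=
  (Finset.Icc 1 h.natDegree).biUnion fun i =>
    ((minExponents u (h.coeff (h.natDegree - i))).filter fun a => a 2 < i).image
      fun a j => (a (Fin.castSucc j) : ℚ) / ((i : ℚ) - (a 2 : ℚ))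

/-- [OURS] The coordinate ideal `(X̄, ū₂, ū_j : j ∈ F)` of `R[X]/(h)` — the face `V(y₁, y₂, u_F)`, `F ⊆ {0,1}`, in the frame whose directrix
variables are `y₁ = X`, `y₂ = u₂`. [folklore] -/
def faceIdeal₂ (u : Fin 3 → R) (h : R[X]) (F : Finset (Fin 2)) : Ideal (R[X] ⧸ Ideal.span {h}) :=
  Ideal.map (Ideal.Quotient.mk (Ideal.span {h}))
    (Ideal.span (insert X (insert (C (u 2)) ((fun j : Fin 2 => C (u (Fin.castSucc j))) '' (F : Set (Fin 2))))))

/-- [OURS · L1 W4.2] **`Reads₂ prep R₀ ν s st`** — `st` is an ADMISSIBLE (2,3)-READING of the marked stage `s` at level `3`, RELATIVE TO THE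
(2,3)-PREPARATION PREDICATE `prep` (C3's `Reads` with `Fin 2` faces, `genPoints₂`, and `prep u h` in place of CP's `IsMinimal u h`): there is a
regular local ring `R` of dimension `3` with r.s.p. `u = (u₀,u₁,u₂)`, a monic `h ∈ R[X]` with `R[X]/(h)` local presenting `𝒪_{X_n,x_n}` (flat local
homomorphism generating the maximal ideal, surjective on residue fields — `Presents`' clauses inlined), the frame `(u; X)` is `prep`-PREPARED
(«(y₁,y₂;u₁,u₂) κ-rational, Δ² well-prepared, CJS Ch. 8» — the notion is NOT in the tree and is supplied by the instance, see `Cell23.prep`),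
`st.A = genPoints₂ u h`, and THE LABEL DICTIONARY holds up to a strictly monotone re-indexing `θ` of labels: every irreducible component `Z` of
`X_n(ν)` through `x_n` is cut out at `x_n` by a face `(X̄, ū₂, ū_F)`, `F ⊆ {0,1}`, with `L_n(Z) = θ (st.lab F)`, and every near component face
arises so. EXISTENCE OF SUCH READINGS IS NOT SHOWN HERE (it is `Cell23.cover₂`). NOT a statement of any manuscript. [folklore] -/
def Reads₂ (prep : ∀ {R : Type} [CommRing R], (Fin 3 → R) → R[X] → Prop)
    (_R₀ : ∀ S : Scheme.{u}, CentreSeq S → Prop) (ν : ℕ → ℕ) (s : MarkedStage.{u}) (st : ShadowState₂) : Prop :=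
  ∃ (R : Type) (_ : CommRing R) (_ : IsRegularLocalRing R) (u : Fin 3 → R) (h : R[X])
    (_ : IsLocalRing (R[X] ⧸ Ideal.span {h})) (φ : (s.W.presheaf.stalk s.pt : Type u) →+* R[X] ⧸ Ideal.span {h}) (θ : ℕ → ℕ),
    ringKrullDim R = 3 ∧ Ideal.span (Set.range u) = IsLocalRing.maximalIdeal R ∧ h.Monic ∧
    IsLocalHom φ ∧ φ.Flat ∧ Ideal.map φ (IsLocalRing.maximalIdeal _) = IsLocalRing.maximalIdeal _ ∧
    Function.Surjective ((IsLocalRing.residue _).comp φ) ∧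
    prep u h ∧ st.A = genPoints₂ u h ∧
    StrictMono θ ∧ θ st.n ≤ s.L.year ∧ (∀ F : Finset (Fin 2), IsNearComp₂ st.A F → st.lab F ≤ st.n) ∧
    (∀ Z ∈ componentsIn (Scheme.hsStratum s.W 3 ν), ∀ (hZ : IsIrreducible Z) (hx : hZ.genericPoint ⤳ s.pt), s.pt ∈ Z →
      ∃ F : Finset (Fin 2), Ideal.map φ (primeOfComponent s.W s.pt Z hZ hx) = faceIdeal₂ u h F ∧ s.L.label Z = θ (st.lab F)) ∧
    (∀ F : Finset (Fin 2), IsNearComp₂ st.A F →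
      ∃ Z ∈ componentsIn (Scheme.hsStratum s.W 3 ν), ∃ (hZ : IsIrreducible Z) (hx : hZ.genericPoint ⤳ s.pt),
        Ideal.map φ (primeOfComponent s.W s.pt Z hZ hx) = faceIdeal₂ u h F ∧ s.L.label Z = θ (st.lab F))

end Readings

/-! ## §3. THE (2,3)-CELL CLAIMS `Cell23` and the packaging into `ShadowLawM p 3 Q Is23Stage` -/

/-- [OURS · L1 W4.2] **THE (2,3)-CELL CLAIMS** for origins of type `Q` (idea-1 IDEAS v5 §I.4, in the shape of C3's `CPrime`): the
(2,3)-preparation predicate `prep` (CJS Ch. 8 well-preparedness of `Δ(h; u₀,u₁; X,u₂)` — NOT in the tree, supplied here; a definition request),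
a well-founded reading-rank (descent = a near point of `ℙ¹ = ℙ(Dir_κ)` that is not `κ(x_n)`-rational, as K3a), and the five named statements,
all on the cell `G := Moving.Is23Stage` (053's T6; `dirDim = 2 ∧ geomDirDim = 3`) at level `3`. EXIT to the (3,3) cell is a canonical near step
whose target is not a (2,3)-stage: it is not bound by `law_moving₂`/`law_waiting₂` (both ask `Is23Stage s'`) — handed to C′/C4 by the chain-level
joins. An instance is EXPECTED only for `p ≥ 3` (CJS Thm 3.14 on threefolds: tree `CossartJannsenSaito2020_thm_3_14` / `Thm314_point_locus`);
`p = 2` is OPEN. NOTHING here asserts that an instance exists. NOT a statement of any manuscript. -/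
structure Cell23 (p : ℕ) (Q : ℕ → (ℕ → ℕ) → ∀ X : Scheme.{u}, X → Prop) : Type 1 where
  /-- THE (2,3)-PREPARATION PREDICATE on CP frames `(u₀,u₁,u₂; X)` over a regular local ring (CJS Ch. 8 «Δ² well-prepared» for the two
  directrix variables `y₁ = X`, `y₂ = u₂`; not in the tree — the instance supplies it) -/
  prep : ∀ {R : Type} [CommRing R], (Fin 3 → R) → R[X] → Prop
  /-- RANK CARRIER (residue-field extensions along `ℙ¹`: the K3a-type descent of the (2,3) cell) -/
  W : Type
  /-- its strict order -/
  wlt : W → W → Prop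
  /-- well-founded -/
  wf : WellFounded wlt
  /-- the rank of a shadow state -/
  rk : ShadowState₂ → W
  /-- COVER₂: every in-scope (2,3)-stage has an admissible `prep`-prepared reading (a CP frame whose last parameter is the second directrix
  variable, adapted to boundary + near components + canonical centre) -/
  cover₂ : ∀ (R : ∀ S : Scheme.{u}, CentreSeq S → Prop), OracleFunctional R → OracleAdmissible R →
    ∀ (ν : ℕ → ℕ) (s : MarkedStage.{u}), InScopeCQ p R 3 ν Q s → Is23Stage s → ∃ st, Reads₂ prep R ν s st
  /-- FIDELITY₂: readings of (2,3)-stages are (2,3)-grade states (`δ(Δ²) > 1 ⇔ in_𝔪 h ∈ κ[Y₁,Y₂]`) -/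
  fidelity₂ : ∀ (R : ∀ S : Scheme.{u}, CentreSeq S → Prop), OracleFunctional R → OracleAdmissible R →
    ∀ (ν : ℕ → ℕ) (s : MarkedStage.{u}) (st : ShadowState₂), InScopeCQ p R 3 ν Q s → Is23Stage s →
      Reads₂ prep R ν s st → IsGrade₂ st.A
  /-- THE MOVING LAW₂: a genuine canonical near step between (2,3)-stages is, on some admissible reading of the new stage, a G2L* move of the
  given reading (origin₂: CP Prop. 2.6 = tree `minExponents_of_mul_pow_eq`; translate₂ + re-preparation along `ℙ¹`) with non-increasing rank,
  OR a strict rank descent (the near point of `ℙ¹ = ℙ(Dir_κ)` is not `κ(x_n)`-rational). At `p ≥ 3` these are ALL genuine steps inside the cell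
  (CJS Thm 3.14: near points lie on `ℙ(Dir_κ)`); at `p = 2` the claim is not expected to hold (near points off `ℙ(Dir_κ)`). -/
  law_moving₂ : ∀ (R : ∀ S : Scheme.{u}, CentreSeq S → Prop), OracleFunctional R → OracleAdmissible R →
    ∀ (ν : ℕ → ℕ) (s s' : MarkedStage.{u}), InScopeCQ p R 3 ν Q s → Is23Stage s → Is23Stage s' →
      CanonicalNearStep R 3 ν s s' → s.IsBlownUp R 3 ν →
      ∀ st, Reads₂ prep R ν s st → ∃ st', Reads₂ prep R ν s' st' ∧
        ((ShadowStepStar₂ st st' ∧ (wlt (rk st') (rk st) ∨ rk st' = rk st)) ∨ wlt (rk st') (rk st))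
  /-- THE WAITING TRANSPORT₂: a waiting step is a local isomorphism at the marked point compatible with strata and labels, so readings are
  transported identically -/
  law_waiting₂ : ∀ (R : ∀ S : Scheme.{u}, CentreSeq S → Prop), OracleFunctional R → OracleAdmissible R →
    ∀ (ν : ℕ → ℕ) (s s' : MarkedStage.{u}), InScopeCQ p R 3 ν Q s → Is23Stage s → Is23Stage s' →
      CanonicalNearStep R 3 ν s s' → ¬ s.IsBlownUp R 3 ν → ∀ st, Reads₂ prep R ν s st → Reads₂ prep R ν s' st
  /-- G2L* terminates -/
  g2l : G2LStarTerminates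

/-- **PACKAGING**: the (2,3)-cell claims are a reading-valued shadow law on the cell `Moving.Is23Stage` with `St := ShadowState₂`,
`step := ShadowStepStar₂`, `good := IsGrade₂ ∘ A`, `reads := Reads₂ prep` (as `shadowLawM_of_cPrime`). [folklore] -/
def shadowLawM_of_cell23 {p : ℕ} {Q : ℕ → (ℕ → ℕ) → ∀ X : Scheme.{u}, X → Prop} (S : Cell23.{u} p Q) :
    ShadowLawM.{u} p 3 Q Is23Stage where
  St := ShadowState₂
  step := ShadowStepStar₂
  good st := IsGrade₂ st.A
  W := S.W
  wlt := S.wlt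
  wf := S.wf
  rk := S.rk
  reads := Reads₂ S.prep
  cover := S.cover₂
  fidelity := S.fidelity₂
  law_moving := S.law_moving₂
  law_waiting := S.law_waiting₂
  terminates := S.g2l

/-- **THE (2,3)-CELL ROW FROM THE CLAIMS (proved reduction)**: `Cell23 p Q` gives «no infinite MOVING chain of canonical near steps from a
maximal `Q`-origin with EVERY stage a (2,3)-stage» (`Moving.MaxOriginNoMovingNearChainAtQ p 3 Q Is23Stage`), by the tree's
`maxOriginNoMovingNearChainAtQ_of_shadowLawM` (p502382) applied to `shadowLawM_of_cell23`. The recurrent / hits forms of the dir-drop cell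
(053's `WtopDirDropCellM`) are chain-level joins and are NOT derived here. [folklore] -/
theorem maxOriginNoMovingNearChainAtQ_of_cell23 {p : ℕ} {Q : ℕ → (ℕ → ℕ) → ∀ X : Scheme.{u}, X → Prop} (S : Cell23.{u} p Q) :
    MaxOriginNoMovingNearChainAtQ.{u} p 3 Q Is23Stage :=
  maxOriginNoMovingNearChainAtQ_of_shadowLawM (shadowLawM_of_cell23 S)

end Summit.ResolutionOfSingularities.ResolutionOfSingularities.Theorems.SigmaMaxModificationsCorridor3.ShadowM

end
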